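import Summits.CriticalPhenomena.PercolationContinuityZ3.Theorems.PercNearOneGluingNoHeavyLowerTailSunflowerPartitionLemma
import HarnessLib
import HarnessLib.Audit

/-!
# `NoHeavyLowerTail` (crux stmt-CriticalPhenomena-4575), abstract sunflower cubic: the THREE-UP-SET form (R2) of the partition lemma and
# three further typed strengthenings (chain-polarised, column-sum, restriction monotonicity) with their implications

Support file (seat `prim-ineq-prove-1` gen 25/26; `--supports stmt-CriticalPhenomena-4575`; companion of `…SunflowerAntipodalGladkov` (p214186),
`…SunflowerPartitionLemma` (p214317), `…SunflowerPromotion`).  Memo: run/shared/lean/prim/prim-ineq-prove-1/ABSTRACT-SUNFLOWER-CUBIC-prove1-g25.md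
§7–§11 (the partition lemma `PartitionLemmaH` there is the cell's M(HQT) fibre statement; the strengthenings below are the cell's OCM / COMB / COMB-M
rows in the abstract sunflower language; none is asserted, all are `@[conjecture]`, census-validated to `|α| = 5` exhaustively).

* `twoOf`, `ofUpsets` — the θ-pullback sunflower of three ARBITRARY up-sets `U₁,U₂,U₃` (kernel = "in at least two", petal `i` = "in `U_i` only",
  bottom = "in none").
* `ThreeUpsetPartitionIneq` (R2, typed conjecture): the partition functional of `ofUpsets U` is `≥ 0`.  Census (ttrl cp-r2): all 7.26·10¹⁰ triples at
  `|α| = 5`, 0 negatives.  `threeUpset_of_partitionLemmaH : PartitionLemmaH → ThreeUpsetPartitionIneq`.  The converse for petal-founded maps is the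
  companion `…SunflowerForcedReduction`.
* `partsOf`, `Sunflower.ZP` (chain-polarised partition sums), `Sunflower.ZF` (column-sum fibres); `ZP_univ_empty`, `ZF_univ_empty`, `ZP_empty`.
* `ChainPolarisedPartitionLemma` (P3), `ColumnSumPartitionLemma` (F2 = comb positivity), `RestrictionMonotonicity` (MZ) — typed conjectures — and the
  proved implications `partitionLemmaH_of_chainPolarised`, `partitionLemmaH_of_columnSum`, `partitionLemmaH_of_restrictionMonotonicity`
  (the last by `Finset` induction: `Z(φ) ≥ Z(φ|_{E∖e}) ≥ … ≥ Z(φ|_∅) = 0`).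
-/

namespace Summit.CriticalPhenomena.PercolationContinuityZ3.Theorems.SunflowerPartition

open Finset

variable {α : Type*} [Fintype α] [DecidableEq α]

/-! ## The θ-pullback sunflower of three arbitrary up-sets and the typed conjecture (R2) -/

/-- Sets lying in at least two of `U₁, U₂, U₃`. [this work] -/
def twoOf (U : Fin 3 → Finset (Finset α)) : Finset (Finset α) := (U 0 ∩ U 1) ∪ (U 0 ∩ U 2) ∪ (U 1 ∩ U 2)

omit [Fintype α] in
/-- Membership in `twoOf`. [this work] -/
theorem mem_twoOf {U : Fin 3 → Finset (Finset α)} {S : Finset α} :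
    S ∈ twoOf U ↔ (S ∈ U 0 ∧ S ∈ U 1) ∨ (S ∈ U 0 ∧ S ∈ U 2) ∨ (S ∈ U 1 ∧ S ∈ U 2) := by
  unfold twoOf; simp only [mem_union, mem_inter, or_assoc]

omit [Fintype α] in
/-- `twoOf` of up-sets is an up-set. [this work] -/
theorem twoOf_upper {U : Fin 3 → Finset (Finset α)} (hU : ∀ i, IsUpperSet (U i : Set (Finset α))) :
    IsUpperSet (twoOf U : Set (Finset α)) := by
  intro S T hST hS
  rw [Finset.mem_coe, mem_twoOf] at hS ⊢
  rcases hS with ⟨h1, h2⟩ | ⟨h1, h2⟩ | ⟨h1, h2⟩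
  · exact Or.inl ⟨hU 0 hST h1, hU 1 hST h2⟩
  · exact Or.inr (Or.inl ⟨hU 0 hST h1, hU 2 hST h2⟩)
  · exact Or.inr (Or.inr ⟨hU 1 hST h1, hU 2 hST h2⟩)

/-- **The θ-pullback sunflower of three arbitrary up-sets**: `V i = U i ∪ twoOf U` (kernel = "in at least two", petal `i` = "in `U i` only").
[this work] -/
def ofUpsets (U : Fin 3 → Finset (Finset α)) (hU : ∀ i, IsUpperSet (U i : Set (Finset α))) : Sunflower α where
  V := fun i => U i ∪ twoOf U
  upper := fun i => by
    intro S T hST hS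
    rw [Finset.mem_coe, mem_union] at hS ⊢
    rcases hS with h | h
    · exact Or.inl (hU i hST h)
    · exact Or.inr (twoOf_upper hU hST h)
  inter_eq := by
    intro i j hij
    ext S
    simp only [mem_inter, mem_union, mem_twoOf]
    fin_cases i <;> fin_cases j <;> simp_all <;> tauto

/-- **(R2) THREE-UP-SET PARTITION INEQUALITY** (this work; OPEN; census-clean: EXHAUSTIVE for `|α| ≤ 5` — all `72 644 055 631` multisets of
up-sets of `2^5` (ttrl census lane, run/shared/lean/ttrl/r2/R2.md) — random and adversarial up to `|α| = 10`; minimum `0`, attained only on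
degenerate triples and on product labelings): for three arbitrary up-sets, the `H`-partition functional of their θ-pullback sunflower is nonnegative.  Together with petal-promotion
monotonicity it implies `PartitionLemmaH` for all petal-founded maps, hence (cloning) `γ`, `G₄`, `H_{q+t}`, `AG⁺`, `T_inc`, `3PT-LB` (memo §8).
An obligation, never a fact: use as `(h : ThreeUpsetPartitionIneq)`. [status: open] -/
@[conjecture] def ThreeUpsetPartitionIneq : Prop :=
  ∀ (α : Type) [Fintype α] [DecidableEq α] (U : Fin 3 → Finset (Finset α)) (hU : ∀ i, IsUpperSet (U i : Set (Finset α))),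
    0 ≤ (ofUpsets U hU).ZH

/-- The partition lemma implies (R2) (the θ-pullback is a sunflower). [this work] -/
theorem threeUpset_of_partitionLemmaH (h : PartitionLemmaH) : ThreeUpsetPartitionIneq :=
  fun α _ _ U hU => h α (ofUpsets U hU)

/-! ## Two polarised strengthenings (typed conjectures, memo §10) and their specialisations to the partition lemma

Both are census-clean (θ-pullbacks: all up-set triples for `|α| ≤ 4` times all configurations, random at `|α| = 5`; general monotone maps:
exhaustive for `|α| ≤ 4`, sampled at `|α| = 5`) and both FAIL as soon as their rigidity hypothesis is dropped (non-chain offsets have negative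
instances at `|α| = 3`).  The pointwise (four-functions-style) exchange inequality that proves the two-block analogue
`Sunflower.antipodal_sum_nonneg` has no three-block counterpart (exact LP, memo §10.4), so neither is claimed to be inductive. -/

/-- Ordered 3-partitions `(X, Y, W ∖ (X ∪ Y))` of a sub-cube `W`, encoded by the disjoint pair `(X,Y)`. [this work] -/
def partsOf (W : Finset α) : Finset (Finset α × Finset α) :=
  (W.powerset ×ˢ W.powerset).filter fun q => Disjoint q.1 q.2

omit [Fintype α] in
/-- `partsOf ∅ = {(∅, ∅)}`. [this work] -/
theorem partsOf_empty : partsOf (∅ : Finset α) = {(∅, ∅)} := by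
  unfold partsOf
  rw [powerset_empty, singleton_product_singleton, filter_singleton]
  simp

/-- `partsOf univ = parts α`. [this work] -/
theorem partsOf_univ : partsOf (univ : Finset α) = parts α := by
  unfold partsOf parts
  rw [powerset_univ, univ_product_univ]

namespace Sunflower

/-- The CHAIN-POLARISED partition functional `Σ_{(X,Y,Z) ⊢ W} s6H (lab (G₁ ∪ X)) (lab (G₂ ∪ Y)) (lab (G₃ ∪ Z))`. [this work] -/
def ZP (F : Sunflower α) (W G₁ G₂ G₃ : Finset α) : ℤ :=
  ∑ q ∈ partsOf W, s6H (F.lab (G₁ ∪ q.1)) (F.lab (G₂ ∪ q.2)) (F.lab (G₃ ∪ (W \ (q.1 ∪ q.2))))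

/-- The COLUMN-SUM partition functional: sum of `s6H (lab x) (lab y) (lab z)` over all `(x,y,z)` with `1_x + 1_y + 1_z = c`, the column-sum
vector `c` being encoded by the chain `m₃ ⊆ m₂ ⊆ m₁` (`c = 3` on `m₃`, `2` on `m₂ ∖ m₃`, `1` on `m₁ ∖ m₂`, `0` elsewhere): on `m₁ ∖ m₂` each
coordinate goes to exactly one of `x,y,z` (partition `q`), on `m₂ ∖ m₃` each coordinate is missing from exactly one (partition `r`). [this work] -/
def ZF (F : Sunflower α) (m₁ m₂ m₃ : Finset α) : ℤ :=
  ∑ q ∈ partsOf (m₁ \ m₂), ∑ r ∈ partsOf (m₂ \ m₃),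
    s6H (F.lab (m₃ ∪ q.1 ∪ ((m₂ \ m₃) \ r.1))) (F.lab (m₃ ∪ q.2 ∪ ((m₂ \ m₃) \ r.2)))
      (F.lab (m₃ ∪ ((m₁ \ m₂) \ (q.1 ∪ q.2)) ∪ (r.1 ∪ r.2)))

/-- `ZH` is the unpolarised case of `ZP`. [this work] -/
theorem ZP_univ_empty (F : Sunflower α) : F.ZP univ ∅ ∅ ∅ = F.ZH := by
  unfold ZP ZH
  rw [partsOf_univ]
  refine sum_congr rfl fun q _ => ?_
  rw [empty_union, empty_union, empty_union, compl_eq_univ_sdiff]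

/-- `ZH` is the case `c ≡ 1` of `ZF`. [this work] -/
theorem ZF_univ_empty (F : Sunflower α) : F.ZF univ ∅ ∅ = F.ZH := by
  unfold ZF ZH
  rw [sdiff_empty, partsOf_univ, sdiff_empty, partsOf_empty]
  refine sum_congr rfl fun q _ => ?_
  rw [sum_singleton]
  simp only [union_empty, empty_union, sdiff_empty]
  rw [compl_eq_univ_sdiff]

end Sunflower

/-- **(P3) CHAIN-POLARISED PARTITION LEMMA** (this work; OPEN, census-clean, memo §10.2): for a sunflower of up-sets, a sub-cube `W` and a
CHAIN of offsets `G₃ ⊆ G₂ ⊆ G₁` disjoint from `W`, `0 ≤ Σ_{(X,Y,Z) ⊢ W} s6H (lab (G₁ ∪ X)) (lab (G₂ ∪ Y)) (lab (G₃ ∪ Z))`.  The three-block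
analogue of `Sunflower.antipodal_sum_nonneg`; false for every non-chain offset pattern.  An obligation, never a fact. [status: open] -/
@[conjecture] def ChainPolarisedPartitionLemma : Prop :=
  ∀ (α : Type) [Fintype α] [DecidableEq α] (F : Sunflower α) (W G₁ G₂ G₃ : Finset α),
    G₃ ⊆ G₂ → G₂ ⊆ G₁ → Disjoint G₁ W → 0 ≤ F.ZP W G₁ G₂ G₃

/-- **(F2) COLUMN-SUM PARTITION LEMMA** (this work; OPEN, census-clean, memo §10.3): for a sunflower of up-sets and every chain
`m₃ ⊆ m₂ ⊆ m₁`, `0 ≤ ZF m₁ m₂ m₃` (the `s6H`-sum over all triples of sets with the prescribed column sums).  By the sorting identity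
`6H = Σ_c μ(m₁)μ(m₂)μ(m₃)·ZF` it gives the law-level cubic `(a+b)(ab − e₂(c)) ≥ e₃(c)` for every product measure directly.
An obligation, never a fact. [status: open] -/
@[conjecture] def ColumnSumPartitionLemma : Prop :=
  ∀ (α : Type) [Fintype α] [DecidableEq α] (F : Sunflower α) (m₁ m₂ m₃ : Finset α),
    m₃ ⊆ m₂ → m₂ ⊆ m₁ → 0 ≤ F.ZF m₁ m₂ m₃

/-- `s6H` vanishes on the diagonal. [this work] -/
theorem s6H_diag : ∀ v : Fin 5, s6H v v v = 0 := by decide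

namespace Sunflower

omit [Fintype α] in
/-- On the empty sub-cube the chain-polarised functional with empty offsets is `s6H (lab ∅) (lab ∅) (lab ∅) = 0`. [this work] -/
theorem ZP_empty (F : Sunflower α) : F.ZP ∅ ∅ ∅ ∅ = 0 := by
  unfold ZP
  rw [partsOf_empty, sum_singleton]
  simp only [union_empty, sdiff_empty]
  exact s6H_diag _

end Sunflower

/-- **(MZ) RESTRICTION MONOTONICITY** (this work; OPEN, census-clean, memo §11): adding a free coordinate to the sub-cube never decreases the
partition functional: for `e ∉ W`, `Σ_{(X,Y,Z) ⊢ W} s6H ≤ Σ_{(X,Y,Z) ⊢ insert e W} s6H` (all offsets empty), i.e. `Z(φ) ≥ Z(φ|_{2^{E∖e}})`.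
Evidence: θ-pullbacks of all up-set triples for `|α| ≤ 4` and all `(W,e)`, random `|α| ≤ 7`; all monotone maps for `|α| ≤ 4`: no violation,
ratio `1` attained.  (The analogous comparison with the UPPER section `φ(· ∪ {e})` is FALSE.)  It implies the partition lemma by a one-line
induction (`partitionLemmaH_of_restrictionMonotonicity`).  An obligation, never a fact. [status: open] -/
@[conjecture] def RestrictionMonotonicity : Prop :=
  ∀ (α : Type) [Fintype α] [DecidableEq α] (F : Sunflower α) (W : Finset α) (e : α), e ∉ W →
    F.ZP W ∅ ∅ ∅ ≤ F.ZP (insert e W) ∅ ∅ ∅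

/-- (MZ) implies the partition lemma: induct on the sub-cube from `ZP ∅ ∅ ∅ ∅ = 0`. [this work] -/
theorem partitionLemmaH_of_restrictionMonotonicity (h : RestrictionMonotonicity) : PartitionLemmaH := by
  intro α _ _ F
  rw [← F.ZP_univ_empty]
  have key : ∀ W : Finset α, 0 ≤ F.ZP W ∅ ∅ ∅ := by
    intro W
    induction W using Finset.induction_on with
    | empty => rw [F.ZP_empty]
    | insert e W he ih => exact le_trans ih (h α F W e he)
  exact key univ

/-- (P3) implies the partition lemma (take `W = univ`, all offsets empty). [this work] -/
theorem partitionLemmaH_of_chainPolarised (h : ChainPolarisedPartitionLemma) : PartitionLemmaH := by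
  intro α _ _ F
  rw [← F.ZP_univ_empty]
  exact h α F univ ∅ ∅ ∅ (subset_refl _) (subset_refl _) (disjoint_empty_left _)

/-- (F2) implies the partition lemma (take `m₁ = univ`, `m₂ = m₃ = ∅`). [this work] -/
theorem partitionLemmaH_of_columnSum (h : ColumnSumPartitionLemma) : PartitionLemmaH := by
  intro α _ _ F
  rw [← F.ZF_univ_empty]
  exact h α F univ ∅ ∅ (subset_refl _) (empty_subset _)


end Summit.CriticalPhenomena.PercolationContinuityZ3.Theorems.SunflowerPartition
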